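import Summits.Ventures.PercRepro.S2ContractionLever
import Mathlib.Data.Finite.Prod

/-!
# PercRepro — S2: THE TOP `m`-SETS THROUGH A SET `W`, BY THE CONTRACTION LEVER (p7, gen 14; sub-claim S2; for the case `ν = 4` of `(14, 7)`)

A top `m`-set `B` at level `5` (`ρ(B) = 5`, `E ∖ B` spanning) with `m ≥ 6` is dependent, so when `B ∩ W` is independent its outside part
`B ∖ W` is dependent in `N := M ／ W` (`S2.contract_dep_sdiff_of_dep_of_indep_inter`). Split the top `m`-sets by `j = |B ∩ W|` (at least `lo`,
the hitting bound of the concentrated case) and by the independence of `B ∩ W`; the map `B ↦ (B ∩ W, B ∖ W)` is injective: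
**`ncard_top_le_sum_contract`** —
  `#{top m-sets} ≤ Σ_{j = lo}^{m} ( I_j(W) · D_{m−j}(N) + Dep_j(W) · C(|E ∖ W|, m − j) )`,
with `I_j(W)` / `Dep_j(W)` the independent / dependent `j`-subsets of `W` and `D_k(N)` the `N`-dependent `k`-subsets of `E ∖ W`. At `(14, 7)`,
`ν = 4` (`W` a flat of `9` points, `N` of nullity `3` on `12` points: `D₂(N) ≤ 6`, `D₃(N) ≤ 70`, `D₁(N) = 0`) the `6`-sets read
`≤ 84·70 + Dep₃·220 + 126·6 + Dep₄·66 + Dep₅·12 + 84` against the kit's `28,392`. Axioms: standard.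
-/

open scoped Matroid

namespace PercRepro

namespace S2

open Set

variable {α : Type}

/-- **The top `m`-sets through `W` by the contraction lever** (`m ≥ 6`, the hitting bound `lo`). -/
theorem ncard_top_le_sum_contract (M : Matroid α) [M.Finite] {W : Set α} (hW : W ⊆ M.E) (m lo : ℕ) (hm : 6 ≤ m)
    (hhit : ∀ B, B ⊆ M.E → B.ncard = m → M.eRk B = 5 → M.eRk (M.E \ B) = M.eRank → lo ≤ (B ∩ W).ncard) :
    {B : Set α | B ⊆ M.E ∧ B.ncard = m ∧ M.eRk B = 5 ∧ M.eRk (M.E \ B) = M.eRank}.ncard ≤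
      ∑ j ∈ Finset.Icc lo m,
        ({T : Set α | T ⊆ W ∧ T.ncard = j ∧ M.Indep T}.ncard *
            {X : Set α | X ⊆ M.E \ W ∧ X.ncard = m - j ∧ (M ／ W).Dep X}.ncard +
          {T : Set α | T ⊆ W ∧ T.ncard = j ∧ M.Dep T}.ncard * ((M.E \ W).ncard.choose (m - j))) := by
  classical
  set Top := {B : Set α | B ⊆ M.E ∧ B.ncard = m ∧ M.eRk B = 5 ∧ M.eRk (M.E \ B) = M.eRank} with hTop
  have hWfin : W.Finite := M.ground_finite.subset hW
  have hRfin : (M.E \ W).Finite := M.ground_finite.sdiff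
  -- the classes
  let A : ℕ → Set (Set α) := fun j => {B ∈ Top | (B ∩ W).ncard = j ∧ M.Indep (B ∩ W)}
  let C : ℕ → Set (Set α) := fun j => {B ∈ Top | (B ∩ W).ncard = j ∧ M.Dep (B ∩ W)}
  have hTopfin : Top.Finite := M.ground_finite.finite_subsets.subset (fun B hB => hB.1)
  have hcover : Top ⊆ ⋃ j ∈ Finset.Icc lo m, (A j ∪ C j) := by
    intro B hB
    obtain ⟨hBE, hBm, hB5, hBs⟩ := hB
    have hBfin : B.Finite := M.ground_finite.subset hBE
    have hj1 : lo ≤ (B ∩ W).ncard := hhit B hBE hBm hB5 hBs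
    have hj2 : (B ∩ W).ncard ≤ m := hBm ▸ Set.ncard_le_ncard Set.inter_subset_left hBfin
    refine Set.mem_iUnion₂.2 ⟨(B ∩ W).ncard, Finset.mem_Icc.2 ⟨hj1, hj2⟩, ?_⟩
    by_cases hind : M.Indep (B ∩ W)
    · exact Or.inl ⟨⟨hBE, hBm, hB5, hBs⟩, rfl, hind⟩
    · exact Or.inr ⟨⟨hBE, hBm, hB5, hBs⟩, rfl, (M.dep_iff.2 ⟨hind, Set.inter_subset_left.trans hBE⟩)⟩
  -- the independent class, injected into a product
  have hA : ∀ j, (A j).ncard ≤ {T : Set α | T ⊆ W ∧ T.ncard = j ∧ M.Indep T}.ncard *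
      {X : Set α | X ⊆ M.E \ W ∧ X.ncard = m - j ∧ (M ／ W).Dep X}.ncard := by
    intro j
    rw [← Set.ncard_prod]
    refine Set.ncard_le_ncard_of_injOn (fun B : Set α => (B ∩ W, B \ W)) ?_ ?_
      ((hWfin.finite_subsets.subset (fun T hT => hT.1)).prod (hRfin.finite_subsets.subset (fun X hX => hX.1)))
    · rintro B ⟨⟨hBE, hBm, hB5, hBs⟩, hj, hind⟩
      have hBfin : B.Finite := M.ground_finite.subset hBE
      have hsplit := Set.ncard_inter_add_ncard_sdiff_eq_ncard B W hBfin
      have hdep : M.Dep B := by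
        rw [← Matroid.eRk_lt_encard_iff_dep_of_finite hBfin hBE, hB5, ← hBfin.cast_ncard_eq, hBm]
        exact_mod_cast (show 5 < m by omega)
      refine Set.mem_prod.2 ⟨⟨Set.inter_subset_right, hj, hind⟩, ⟨sdiff_subset_sdiff_left hBE, ?_, ?_⟩⟩
      · show (B \ W).ncard = m - j
        omega
      exact contract_dep_sdiff_of_dep_of_indep_inter M hW hBE hdep hind
    · rintro B₁ - B₂ - hEq
      simp only [Prod.mk.injEq] at hEq
      rw [← Set.inter_union_sdiff B₁ W, ← Set.inter_union_sdiff B₂ W, hEq.1, hEq.2]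
  -- the dependent class, injected into a product
  have hC : ∀ j, (C j).ncard ≤ {T : Set α | T ⊆ W ∧ T.ncard = j ∧ M.Dep T}.ncard * ((M.E \ W).ncard.choose (m - j)) := by
    intro j
    rw [← ncard_subsets_ncard_eq (M.E \ W) hRfin (m - j), ← Set.ncard_prod]
    refine Set.ncard_le_ncard_of_injOn (fun B : Set α => (B ∩ W, B \ W)) ?_ ?_
      ((hWfin.finite_subsets.subset (fun T hT => hT.1)).prod (hRfin.finite_subsets.subset (fun X hX => hX.1)))
    · rintro B ⟨⟨hBE, hBm, -, -⟩, hj, hdep⟩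
      have hBfin : B.Finite := M.ground_finite.subset hBE
      have hsplit := Set.ncard_inter_add_ncard_sdiff_eq_ncard B W hBfin
      refine Set.mem_prod.2 ⟨⟨Set.inter_subset_right, hj, hdep⟩, ⟨sdiff_subset_sdiff_left hBE, ?_⟩⟩
      show (B \ W).ncard = m - j
      omega
    · rintro B₁ - B₂ - hEq
      simp only [Prod.mk.injEq] at hEq
      rw [← Set.inter_union_sdiff B₁ W, ← Set.inter_union_sdiff B₂ W, hEq.1, hEq.2]
  calc Top.ncard ≤ (⋃ j ∈ Finset.Icc lo m, (A j ∪ C j)).ncard :=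
        Set.ncard_le_ncard hcover (Set.Finite.biUnion (Finset.Icc lo m).finite_toSet
          (fun j _ => (hTopfin.subset (fun B hB => hB.1)).union (hTopfin.subset (fun B hB => hB.1))))
    _ ≤ ∑ j ∈ Finset.Icc lo m, (A j ∪ C j).ncard := Finset.set_ncard_biUnion_le _ _
    _ ≤ ∑ j ∈ Finset.Icc lo m, ((A j).ncard + (C j).ncard) :=
        Finset.sum_le_sum (fun j _ => Set.ncard_union_le _ _)
    _ ≤ _ := Finset.sum_le_sum (fun j _ => Nat.add_le_add (hA j) (hC j))

end S2

end PercRepro
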